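import Mathlib
import HarnessLib
import HarnessLib.Audit
import Summits.Langlands.Statement
import Literature.NumberTheory.GaloisRepresentations.ModPGaloisRep
import Literature.NumberTheory.EllipticCurves.GaloisAction
import Literature.Barriers.Langlands.TaylorWilesNumericalCoincidence

/-!
Route: NewtonPatching

Route NewtonPatching (card Langlands/Langlands/newton-bound-as-patching). It suffices to show X =
NewtonPatchingTarget: for every CM field K there are reciprocity data RD such that (i) direction (A)
with local-global compatibility at every finite place holds for REGULAR L-algebraic cuspidal pi of
GL_n(A_K) (all n), and (ii) every irreducible geometric rho : Gamma_K -> GL_n(Qbar_ell) with ell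
totally split in K, crystalline with n distinct Hodge-Tate weights at each v | ell (rendered through
RD.pst: de Rham, WD unramified with N = 0, and n distinct weights of a Q_ell-model), and residually
absolutely irreducible and congruent (a.e. Frobenius characteristic polynomials mod the maximal
ideal of Zbar_ell) to a regular L-algebraic cuspidal pi_0, corresponds (Corresponds RD iota pi rho)
to an L-algebraic cuspidal pi. Lean: `Summit.Langlands.Langlands.Theses.NewtonPatching.Target`
(one-line Prop over Summit.Langlands.{ReciprocityData, IsGeometricFramed, Corresponds},
Literature.NumberTheory.GaloisRepresentations.{FramedGaloisRep, ModPGaloisRep,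
FramedRep.IsAbsolutelyIrreducible, PstWeilDeligneData, PeriodRingData.hodgeTateWeights},
Literature.NumberTheory.Automorphic.{CuspidalAutomorphicRepData, InfinityType.IsRegular, HasQlModel,
restrictScalarsQl, arithFrobPolyOfSatake}; Sketch.lean rc 0). The mechanism aimed at X: over a CM
field of degree 2d, Newton's lower bound dim X_i >= dim W_{K^p} - l(x) for the GL_n eigenvariety
(Hansen–Newton, Crelle 730, Thm 1.1.6; l_0 = d(n-1) = Literature.Barriers.Langlands.defectGL 0 d n)
and the Greenberg–Wiles/BHS upper bound for the global trianguline deformation space COINCIDE at dn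
+ 1 + delta_K (support item Numerology), so vanishing of the dual trianguline Selmer group makes the
eigenvariety a union of irreducible components of the trianguline space with no patching and no
Zariski density (false over CM: Calegari–Mazur), and one pro-automorphic point per component gives
Hansen's Conjecture 1.2.3 (occurrence iff trianguline); classicality of non-critical crystalline
points then yields X. Assembly (bookkeeping, provable by cases on IsCMField): Target -> (Target ->
Langlands over CM fields) -> (Langlands over non-CM fields) -> Langlands.

Rationale: WHY THIS LINE. Direction (B) over CM fields K ([K:Q] = 2d) has positive defect l_0 = d(n-1) (tree:
Literature.Barriers.Langlands.defectGL_totallyComplex), which kills single-degree Taylor–Wiles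
patching. The card turns the defect inside out: the SAME number is the drop in Newton's lower bound
for the GL_n eigenvariety X (Hansen–Newton arXiv:1412.1533, Thm 1.1.6: dim X_i >= dim W_{K^p} -
l(x); Thm 1.1.5: equality when l_0 <= 1) and in the Greenberg–Wiles count for the global trianguline
deformation space X^glob_tri(rhobar) (local trianguline varieties equidimensional of dim n^2 +
[K_v:Q_p] n(n+1)/2, BHS arXiv:1411.7260 / arXiv:1702.02192): both give dn + 1 + delta_K (support
Numerology, provable now from NumberField.Units.rank and defectGL). Hence: dual-trianguline-Selmer
vanishing => X^glob_tri equidimensional of that dimension => X (closed in it: McDonald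
arXiv:2504.18319 Thm 1 for Fu's derived eigenvarieties, decomposed generic, p split in an imaginary
quadratic subfield) is a UNION OF COMPONENTS (support UnionOfComponents, Mathlib-sized) — the
statement BHS obtain for definite unitary groups BY PATCHING — and "occurrence iff trianguline"
(Hansen Conj. 1.2.3) reduces to one pro-automorphic point per component; no Zariski density of
classical points is needed (it is false here: Calegari–Mazur arXiv:0708.2451 Thm 1.1). Imported
areas: rigid-analytic geometry of eigenvarieties/trianguline varieties + Poitou–Tate duality (Galois
cohomology) + commutative algebra of equidimensional spaces. Ordinary shadow in print: Khare–Thorne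
AJM 2017 (arXiv:1409.7007) and Calegari–Mazur §1.1.
RANKED CRUXES. (2) DirARegularCM [typed]: (A) with local–global compatibility at all places for
regular L-algebraic cuspidal pi over CM K — the unproved named-fact input (determinants, crystalline
periods at classical points; also needed to upgrade a.e. matching to `Corresponds`, support
WeakToStrong); per instruction the first crux. (3) DualTriangulineSelmerVanishing: H^1_{tri-perp}(K,
ad rho(1)) = 0 on a Zariski-dense set of each component of X^glob_tri(rhobar) (equidimensionality
dn+1+delta_K) — the heart. (4) OnePointPerComponent: every component of X^glob_tri(rhobar) contains
a point of X of full local dimension. (5) ClassicalityNonCritical: crystalline HT-regular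
non-critical (generic) points of X are cuspidal cohomological. (6) EigenvarietyPackage: ONE
eigenvariety for Res GL_n/K carrying simultaneously Newton's bound, a Galois determinant with LGC
away from p, McDonald's triangulinity, and classical = cuspidal cohomological points (overconvergent
vs derived-completed constructions are not known to agree). (7) BianchiCase [typed]: X for n = 2, K
imaginary quadratic (l_0 = 1, Hansen Thm 1.1.5 exact dimension; first rung).
SUPPORT (typed, unranked): Numerology; UnionOfComponents; WeakToStrong ((A) + a.e. Satake–Frobenius
matching + irreducible => Corresponds; Chebotarev + Brauer–Nesbitt, both in tree);
EllipticAnySlopeCM (weight-0 elliptic face; essentially covered by ACCGHLNSTT2023 §6 and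
Caraiani–Newton arXiv:2301.10509 §5 — calibration); RestCM, NonCM (the honest complement); Assembly.
TYPING NOTES. p-adic Hodge hypotheses are datum-relative in this tree, so every (B)-item sits under
the summit-shaped `forall K, exists RD, (A)_reg /\ Sector` ((A) forces the datum to declare the
genuine rho_pi de Rham; a `forall RD` form would be false for Hodge–Tate-type junk data). Labelled
HT weights are not expressible (ReciprocityGLn design note), so regularity is typed only for ell
totally split in K (n distinct weights of the Q_ell-linear model) — also the eigenvariety-friendly
case. `𝓡` is Manifold notation in route files; binder renamed RD.
KILL CRITERIA. (a) A component of X^glob_tri(rhobar) (rhobar automorphic, adequate, decomposed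
generic) with no pro-automorphic point, or of dimension > dn+1+delta_K through a generic crystalline
point (refutes cruxes 3/4 and Hansen 1.2.3); (b) a Rawson-type tangent-space computation
(arXiv:2402.13799) at a generic non-CM non-base-change classical Bianchi point giving dim T_x X > 3;
(c) refutation of BianchiCase; (d) if crux 6 fails because Newton's bound and triangulinity live on
provably different eigenvarieties with no comparison, the line closes.
NOT DECOMPOSED YET. Glue cruxes 2–6 => Target (needs definitions TriangulineAt,
GlobalTriangulineSpace, DualTriangulineSelmer, Eigenvariety; requested); non-generic/critical
crystalline points (companion points; BHS arXiv:1702.02192 local model and its non-regular extension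
by Wu 2024 as cited in arXiv:2504.18319 §6.2); Leopoldt bookkeeping beyond delta_K on both sides;
non-split ell; residually reducible or inadequate rhobar (ResiduallyReducibleBarrier respected, not
evaded).

Novelty: NOVELTY (searches run 2026-08-15: `lit search --source zbmath` on "eigenvariety" (2012+), "universal
eigenvarieties trianguline Galois representations", "derived eigenvariety", "modularity elliptic
curves imaginary quadratic", "local-global compatibility torsion cohomology crystalline", "infinite
fern Galois deformation unitary"; `lit frontier Langlands --since 2020`; `lit bridges Langlands
--cross any`; read: arXiv:2504.18319 pp.1–7, 46–53; arXiv:1412.1533 pp.6–8; arXiv:2301.10509 pp.1–6;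
arXiv:2110.04797 pp.2–4; arXiv:2605.03519 pp.2–3; local searchd/OpenAlex/S2/arXiv-API unavailable or
rate-limited at the time, zbMATH used).
Nearest prior art: (1) Breuil–Hellmann–Schraen, Math. Ann. 367 (2017), arXiv:1411.7260 —
"eigenvariety = union of irreducible components of the global trianguline deformation space", for
DEFINITE UNITARY groups (defect zero), proved BY PATCHING (patched eigenvariety), equality
conjectured; local model arXiv:1702.02192. (2) Hansen–Newton, Crelle 730 (2017), arXiv:1412.1533 —
Newton's bound Thm 1.1.6, exact dimension for l_0 <= 1 (Thm 1.1.5), Conjectures 1.2.2–1.2.5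
(pointwise occurrence iff trianguline), no comparison with a Galois deformation space. (3) McDonald,
arXiv:2504.18319 (2025) — NEW since the card: proves the "=>" half (points of Fu's derived GL_n/CM
eigenvarieties are trianguline with the expected Sen weights; decomposed generic, p split in an
imaginary quadratic subfield) by degree shifting into the U(n,n) middle-degree eigenvariety; its §6  [refs: 2504.18319, 1412.1533, 2301.10509, 2110.04797, 2605.03519, 1411.7260, 1702.02192, 1409.7007, 0708.2451, 1811.09116, 2210.10564, 0911.5726]

Barriers (technique_class: eigenvariety p-adic-interpolation completed-cohomology): technique_class: eigenvariety p-adic-interpolation completed-cohomology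
- Literature.Barriers.Langlands.TaylorWilesNumericalCoincidence: the barrier's own quantity defectGL
0 d n = d(n-1) is the route's subject turned inside out — it is the drop on BOTH sides of the count
(support Numerology), no Taylor–Wiles primes and no patched module are used; the barrier blocks
single-degree patching, which the line does not run. Honest residue: the seed "rhobar automorphic
with one smooth automorphic point" imports a ten-author/a'Campo-type input once (crux
OnePointPerComponent).
- Literature.Barriers.Langlands.TaylorWilesNumericalCoincidenceNarrow: same; rho is not assumed
polarizable (no passage to G_n), the CM hypothesis enters only through Galois determinants (Scholze)
and McDonald's U(n,n) boundary argument inside crux EigenvarietyPackage.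
- Literature.Barriers.Langlands.PatchingLocalComponentBarrier: evaded in form — no fixed-weight
local deformation ring, the local condition is "trianguline", whose variety is irreducible at
generic points (BHS local model); the analogue reappears GLOBALLY and is named, not hidden: crux
OnePointPerComponent (components of the global trianguline space without automorphic points).
- Literature.Barriers.Langlands.ResiduallyReducibleBarrier: not evaded and not engaged: every item
assumes rhobar absolutely irreducible (typed: FramedRep.IsAbsolutelyIrreducible of a ModPGaloisRep
congruent to rho) and residually cuspidal-automorphic.
- Literature.Barrier

sub-problem: Langlands · status: done · opened planner-plancard-Langlands-Langlands-newton-b-f657396f-0 2026-08-15T11:03:23Z · rev 1 · ledger route-Langlands-NewtonPatching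
GENERATED by the gate from the ledger (D-0016/17). Provers cite these decls: `theorem foo : Summit.Langlands.Langlands.Theses.NewtonPatching.<Decl> := …` in Summits/Langlands/Langlands/Theorems/<Name>.lean.
-/

namespace Summit.Langlands.Langlands.Theses.NewtonPatching

open scoped BigOperators Topology Manifold Classical MeasureTheory ProbabilityTheory Matrix InnerProductSpace ComplexConjugate ContinuousMap
open Filter Set Function TopologicalSpace MeasureTheory

attribute [summit_statement] _root_.Langlands

/-- item stmt-Langlands-2378 · target · rank 0 · open · by planner
why it might fail: Includes non-generic/critical crystalline rho and irreducibility of rho_pi (n>=3) which no crux controls; RD-relative p-adic Hodge clauses inherit the summit's placeholder status (PstWeilDeligneData).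
sources: arXiv:1412.1533, arXiv:2504.18319, arXiv:1411.7260, BuzzardGeeLMS2014
[target] X of route NewtonPatching: over every CM field K there are reciprocity data RD with (i)
direction (A) + local-global compatibility at every finite place for REGULAR L-algebraic cuspidal pi
of GL_n(A_K), all n, and (ii) the regular-crystalline residually-cuspidal-automorphic sector of
direction (B): ell totally split in K; rho irreducible, geometric (RD), crystalline at v | ell (de
Rham + Weil–Deligne representation unramified with N = 0 through RD.pst) with n distinct Hodge–Tate
weights (toFinset.card of the weights of a finite Q_ell-model = n; = HT-regular since K_v = Q_ell);
rhobar rendered junk-free as a ModPGaloisRep over a discrete char-ell field, absolutely irreducible,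
a.e. Frobenius charpolys congruent to those of rho through theta : O_{Qbar_ell} -> k and to the
Satake–Frobenius polynomials of a regular L-algebraic cuspidal pi_0; conclusion: exists pi
L-algebraic cuspidal with Corresponds RD iota pi rho. The two conjuncts share RD on purpose ((A)
pins the p-adic Hodge datum from below; a `forall RD` sector statement would be false for
Hodge–Tate-type junk data). What the mechanism (cruxes 2–6) is meant to deliver: Hansen occurrence
(arXiv:1412.1533 Conj. 1.2.3) + c -/
@[route_item "route-Langlands-NewtonPatching"]
def Target : Prop :=
  ∀ (K : Type) [Field K] [NumberField K], NumberField.IsCMField K → ∃ RD : Summit.Langlands.ReciprocityData K, (∀ (n : ℕ), 0 < n → ∀ (hcpt : Literature.NumberTheory.Automorphic.isCompact_glFiniteIntegralLevel n K) (π : Literature.NumberTheory.Automorphic.CuspidalAutomorphicRepData n K hcpt), π.1.IsLAlgebraic → (∃ T : Literature.NumberTheory.Automorphic.InfinityType K n, π.1.HasInfinityType T ∧ T.IsRegular) → ∀ (ℓ : ℕ) [Fact ℓ.Prime] (ι : PadicAlgCl ℓ ≃+* ℂ), ∃ ρ : Literature.NumberTheory.GaloisRepresentations.FramedGaloisRep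 K (PadicAlgCl ℓ) n, ρ.toGaloisRep.IsIrreducible ∧ Summit.Langlands.IsGeometricFramed RD ρ ∧ Summit.Langlands.Corresponds RD ι π.1 ρ) ∧ (∀ (n : ℕ), 0 < n → ∀ (hcpt : Literature.NumberTheory.Automorphic.isCompact_glFiniteIntegralLevel n K) (ℓ : ℕ) [Fact ℓ.Prime] (ι : PadicAlgCl ℓ ≃+* ℂ) (ρ : Literature.NumberTheory.GaloisRepresentations.FramedGaloisRep K (PadicAlgCl ℓ) n), (∀ v : IsDedekindDomain.HeightOneSpectrum (NumberField.RingOfIntegers K), ((ℓ : ℕ) : NumberField.RingOfIntegers K) ∈ v.asIdeal → v.residueCard = ℓ ∧ ¬ v.asIdeal ^ 2 ∣ Ideal.span {((ℓ : ℕ) : NumberField.RingOfIntegers K)}) → ρ.toGaloisRep.IsIrreducible → Summit.Langlands.IsGeometricFramed RD ρ → (∀ (v : IsDedekindDomain.HeightOneSpectrum (NumberField.RingOfIntegers K)) (hv : ((ℓ : ℕ) : NumberField.RingOfIntegers K) ∈ v.asIdeal), (∀ r, (RD.pst ℓ v hv).IsWeilDeligneOf (ρ.toLocal v) r → r.N =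 0 ∧ Literature.NumberTheory.GaloisRepresentations.WeilGroup.IsUnramifiedRep r.ρ) ∧ ∃ (E : IntermediateField ℚ_[ℓ] (PadicAlgCl ℓ)) (_ : FiniteDimensional ℚ_[ℓ] E) (rE : Literature.NumberTheory.GaloisRepresentations.FramedGaloisRep (v.adicCompletion K) E n), Literature.NumberTheory.Automorphic.HasQlModel (ρ.toLocal v) E rE ∧ (letI := (RD.pst ℓ v hv).algebra; ((RD.pst ℓ v hv).𝔅.hodgeTateWeights (Literature.NumberTheory.Automorphic.restrictScalarsQl E rE)).toFinset.card = n)) → (∃ (k : Type) (_ : Field k) (_ : CharP k ℓ) (_ : TopologicalSpace k) (_ : DiscreteTopology k) (θ : ↥(Valued.v : Valuation (PadicAlgCl ℓ) NNReal).valuationSubring →+* k) (ρb : Literature.NumberTheory.GaloisRepresentations.ModPGaloisRep K k n) (π₀ : Literature.NumberTheory.Automorphic.CuspidalAutomorphicRepData n K hcpt), Literature.NumberTheory.GaloisRepresentations.FramedRep.IsAbsolutelyIrreducible ρb ∧ π₀.1.IsLAlgebraic ∧ (∃ T : Literature.NumberTheory.Automorphic.InfinityType K n, π₀.1.HasInfinityType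 T ∧ T.IsRegular) ∧ ∀ᶠ v : IsDedekindDomain.HeightOneSpectrum (NumberField.RingOfIntegers K) in cofinite, ∃ (P P₀ : Polynomial ↥(Valued.v : Valuation (PadicAlgCl ℓ) NNReal).valuationSubring) (Pb : Polynomial k) (α : Multiset ℂ), ρ.HasFrobCharpolyAt v (P.map (Valued.v : Valuation (PadicAlgCl ℓ) NNReal).valuationSubring.subtype) ∧ ρb.HasFrobCharpolyAt v Pb ∧ P.map θ = Pb ∧ π₀.1.HasSatakeParamAt v α ∧ P₀.map (Valued.v : Valuation (PadicAlgCl ℓ) NNReal).valuationSubring.subtype = Literature.NumberTheory.Automorphic.arithFrobPolyOfSatake ι v.residueCard 1 α ∧ P₀.map θ = Pb) → ∃ π : Literature.NumberTheory.Automorphic.CuspidalAutomorphicRepData n K hcpt, π.1.IsLAlgebraic ∧ Summit.Langlands.Corresponds RD ι π.1 ρ)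

/-- item stmt-Langlands-2379 · crux · rank 2 · open · by planner
why it might fail: Irreducibility of rho_pi is open for n >= 3 beyond density-one sets of primes; the monodromy operator in WD matching at ramified v ∤ ell and full D_pst matching at ramified v | ell are open outside (potentially) crystalline/ordinary cases.
sources: HarrisLanTaylorThorneRMS2016, VarmaFMS2024, arXiv:2301.10509, arXiv:2603.19768, ACCGHLNSTT2023
[crux] Direction (A) with local–global compatibility at EVERY finite place (summit `Corresponds`,
incl. v | ell through RD.pst) and irreducibility, for regular L-algebraic cuspidal pi of GL_n over a
CM field, packaged as `forall K CM, exists RD, ...`. This is the unproved named-fact input of the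
mechanism (Galois determinants over the eigenvariety with LGC away from p: Scholze 2015 + Varma
2024; crystalline periods / HT weights at classical points: A'Campo 2023-24, Caraiani–Newton
arXiv:2301.10509 Thm 4.3.1; tree:
Literature.NumberTheory.Automorphic.exists_galoisRep_of_regularAlgebraic is the a.e.-Satake part
only) and it is what support WeakToStrong consumes to turn a.e. matching into `Corresponds`. Filed
as the FIRST crux per the plancard instruction (routes resting on unproved facts get no provers
until they land). Partial closes worth filing with --supports: n = 2 over imaginary quadratic K; the
semisimplified v ∤ ell statement (Varma). -/
@[route_item "route-Langlands-NewtonPatching"]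
def DirARegularCM : Prop :=
  ∀ (K : Type) [Field K] [NumberField K], NumberField.IsCMField K → ∃ RD : Summit.Langlands.ReciprocityData K, ∀ (n : ℕ), 0 < n → ∀ (hcpt : Literature.NumberTheory.Automorphic.isCompact_glFiniteIntegralLevel n K) (π : Literature.NumberTheory.Automorphic.CuspidalAutomorphicRepData n K hcpt), π.1.IsLAlgebraic → (∃ T : Literature.NumberTheory.Automorphic.InfinityType K n, π.1.HasInfinityType T ∧ T.IsRegular) → ∀ (ℓ : ℕ) [Fact ℓ.Prime] (ι : PadicAlgCl ℓ ≃+* ℂ), ∃ ρ : Literature.NumberTheory.GaloisRepresentations.FramedGaloisRep K (PadicAlgCl ℓ) n, ρ.toGaloisRep.IsIrreducible ∧ Summit.Langlands.IsGeometricFramed RD ρ ∧ Summit.Langlands.Corresponds RD ι π.1 ρ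

-- item stmt-Langlands-2511 · crux · rank 3 · open · by planner — informal only, no Lean statement yet:
--   [crux] DualTriangulineSelmerVanishing (rank 3; the heart). For K CM with [K:Q] = 2d, rhobar :
--   Gamma_K -> GL_n(Fbar_p) absolutely irreducible, automorphic (cuspidal cohomological), decomposed
--   generic, p totally split (first pass), S ⊇ {v | p} ∪ ramification: the global trianguline
--   deformation space X^glob_tri(rhobar, S) := (Spf R_{rhobar,S})^rig ×_{∏_{v|p} X^□(rhobar_v)} ∏_{v|p}
--   X^□_tri(rhobar_v) is EQUIDIMENSIONAL of dimension dn + 1 + delta_K (delta_K = Leopoldt defect of K).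
--   Sufficient (and the intended form): at a Zariski-dense set of points x of every irreducible
--   component, the dual triang

-- item stmt-Langlands-2506 · crux · rank 4 · open · by planner — informal only, no Lean statement yet:
--   [crux] OnePointPerComponent (rank 4). Same setting. Every irreducible component C of
--   X^glob_tri(rhobar, S) contains a point x of the eigenvariety X_{GL_n/K}(rhobar) (crux
--   EigenvarietyPackage) at which some irreducible component of X through x has dimension >= dim C
--   (then, with crux DualTriangulineSelmerVanishing and support UnionOfComponents, C ⊂ X, i.e. X =
--   X^glob_tri: Hansen–Newton arXiv:1412.1533 Conjecture 1.2.3 'rho occurs iff trianguline at p' for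
--   lifts of rhobar unramified outside S). Intended proof shape: X^glob_tri(rhobar) is connected through
--   generic crystalline points and contains o

-- item stmt-Langlands-2510 · crux · rank 5 · open · by planner — informal only, no Lean statement yet:
--   [crux] ClassicalityNonCritical (rank 5). A point x of the GL_n/K eigenvariety (crux
--   EigenvarietyPackage) whose Galois representation rho_x is crystalline at every v | p with HT-regular
--   weights, GENERIC Frobenius (phi_i/phi_j ∉ {1, q_v}) and NON-CRITICAL refinement (Hodge filtration in
--   general position with the refinement flag; numerically non-critical = small slope as the first case)
--   is classical: its eigensystem occurs in cuspidal cohomology H^*_cusp(Y(K^p K_p), V_lambda), i.e.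
--   comes from a cuspidal cohomological (regular L-algebraic up to twist) pi of GL_n(A_K). Small slope:
--   Hansen–Newton /

-- item stmt-Langlands-2513 · crux · rank 6 · open · by planner — informal only, no Lean statement yet:
--   [crux] EigenvarietyPackage (rank 6; construction statement for the posited object — never smuggled
--   into an interface). For K CM, n >= 2, p, tame level K^p and rhobar non-Eisenstein decomposed
--   generic, there is ONE rigid space X = X_{GL_n/K, K^p}(rhobar) over weight space W_{K^p} (dim W =
--   n[K:Q] - rank of the closure of O_K^×, Hansen arXiv:1412.1533 §3) × T̂ carrying SIMULTANEOUSLY: (i)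
--   Newton's bound: every irreducible component through x has dim >= dim W - l(x), with l(x) = l_0 =
--   d(n-1) at interior non-critical regular classical points (arXiv:1412.1533 Thm 1.1.6, Thm 1.1.5 for
--   l_0 <= 1); (ii)

/-- item stmt-Langlands-2380 · crux · rank 7 · open · by planner
why it might fail: Non-ordinary crystalline weight >= ell-1 lifting over imaginary quadratic K is in no printed theorem (FL/ordinary: ACC+; BT: Caraiani–Newton, whose Thm 1.3 excludes F = F0); via this route it needs cruxes 3-6 at n=2, and non-generic points (a_v = 0 supersingular) are inside the statement.
sources: arXiv:1412.1533, arXiv:2301.10509, ACCGHLNSTT2023, arXiv:0708.2451, arXiv:2504.18319, arXiv:1910.12986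
[crux] First rung / acid test: the Target specialised to n = 2 and K imaginary quadratic ([K:Q] =
2), both conjuncts at n = 2. Here l_0 = 1 and Newton's bound is an EQUALITY (Hansen–Newton
arXiv:1412.1533 Thm 1.1.5: components through strongly interior non-critical regular classical
points have dimension exactly dim W - 1 = 3), the weight space needs no unit quotient, the Galois
count is 1 + 2 + 0 = 3 (Leopoldt known for imaginary quadratic K), Calegari–Mazur arXiv:0708.2451
computed the ordinary shadow, and McDonald arXiv:2504.18319 Example 75 / Conjecture 1 isolates
exactly what is missing for the embedding into X_tri at p split. As a stand-alone statement it is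
automorphy of 2-dimensional crystalline representations of ANY regular weight and ANY slope at a
split ell over imaginary quadratic K, given residual cuspidal-cohomological automorphy and absolute
irreducibility of rhobar — beyond Fontaine–Laffaille (weights < ell - 1), ordinary (ACCGHLNSTT2023
§6) and Barsotti–Tate (Caraiani–Newton arXiv:2301.10509 §5; their Thm 1.3 LGC excludes F = F_0)
ranges. A Calegari–Geraghty patching proof with CN-type crystalline LGC and GL_2(Q_ell) crystalline
local rings is the competing route; -/
@[route_item "route-Langlands-NewtonPatching"]
def BianchiCase : Prop :=
  ∀ (K : Type) [Field K] [NumberField K], NumberField.IsCMField K → Module.finrank ℚ K = 2 → ∃ RD : Summit.Langlands.ReciprocityData K, (∀ (hcpt : Literature.NumberTheory.Automorphic.isCompact_glFiniteIntegralLevel 2 K) (π : Literature.NumberTheory.Automorphic.CuspidalAutomorphicRepData 2 K hcpt), π.1.IsLAlgebraic → (∃ T : Literature.NumberTheory.Automorphic.InfinityType K 2, π.1.HasInfinityType T ∧ T.IsRegular) → ∀ (ℓ : ℕ) [Fact ℓ.Prime] (ι : PadicAlgCl ℓ ≃+* ℂ), ∃ ρ : Literature.NumberTheory.GaloisRepresentations.FramedGaloisRep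 K (PadicAlgCl ℓ) 2, ρ.toGaloisRep.IsIrreducible ∧ Summit.Langlands.IsGeometricFramed RD ρ ∧ Summit.Langlands.Corresponds RD ι π.1 ρ) ∧ (∀ (hcpt : Literature.NumberTheory.Automorphic.isCompact_glFiniteIntegralLevel 2 K) (ℓ : ℕ) [Fact ℓ.Prime] (ι : PadicAlgCl ℓ ≃+* ℂ) (ρ : Literature.NumberTheory.GaloisRepresentations.FramedGaloisRep K (PadicAlgCl ℓ) 2), (∀ v : IsDedekindDomain.HeightOneSpectrum (NumberField.RingOfIntegers K), ((ℓ : ℕ) : NumberField.RingOfIntegers K) ∈ v.asIdeal → v.residueCard = ℓ ∧ ¬ v.asIdeal ^ 2 ∣ Ideal.span {((ℓ : ℕ) : NumberField.RingOfIntegers K)}) → ρ.toGaloisRep.IsIrreducible → Summit.Langlands.IsGeometricFramed RD ρ → (∀ (v : IsDedekindDomain.HeightOneSpectrum (NumberField.RingOfIntegers K)) (hv : ((ℓ : ℕ) : NumberField.RingOfIntegers K) ∈ v.asIdeal), (∀ r, (RD.pst ℓ v hv).IsWeilDeligneOf (ρ.toLocal v) r → r.N = 0 ∧ Literature.NumberTheory.GaloisRepresentations.WeilGroup.IsUnramifiedRep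 r.ρ) ∧ ∃ (E : IntermediateField ℚ_[ℓ] (PadicAlgCl ℓ)) (_ : FiniteDimensional ℚ_[ℓ] E) (rE : Literature.NumberTheory.GaloisRepresentations.FramedGaloisRep (v.adicCompletion K) E 2), Literature.NumberTheory.Automorphic.HasQlModel (ρ.toLocal v) E rE ∧ (letI := (RD.pst ℓ v hv).algebra; ((RD.pst ℓ v hv).𝔅.hodgeTateWeights (Literature.NumberTheory.Automorphic.restrictScalarsQl E rE)).toFinset.card = 2)) → (∃ (k : Type) (_ : Field k) (_ : CharP k ℓ) (_ : TopologicalSpace k) (_ : DiscreteTopology k) (θ : ↥(Valued.v : Valuation (PadicAlgCl ℓ) NNReal).valuationSubring →+* k) (ρb : Literature.NumberTheory.GaloisRepresentations.ModPGaloisRep K k 2) (π₀ : Literature.NumberTheory.Automorphic.CuspidalAutomorphicRepData 2 K hcpt), Literature.NumberTheory.GaloisRepresentations.FramedRep.IsAbsolutelyIrreducible ρb ∧ π₀.1.IsLAlgebraic ∧ (∃ T : Literature.NumberTheory.Automorphic.InfinityType K 2, π₀.1.HasInfinityType T ∧ T.IsRegular) ∧ ∀ᶠ v : IsDedekindDomain.HeightOneSpectrum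 (NumberField.RingOfIntegers K) in cofinite, ∃ (P P₀ : Polynomial ↥(Valued.v : Valuation (PadicAlgCl ℓ) NNReal).valuationSubring) (Pb : Polynomial k) (α : Multiset ℂ), ρ.HasFrobCharpolyAt v (P.map (Valued.v : Valuation (PadicAlgCl ℓ) NNReal).valuationSubring.subtype) ∧ ρb.HasFrobCharpolyAt v Pb ∧ P.map θ = Pb ∧ π₀.1.HasSatakeParamAt v α ∧ P₀.map (Valued.v : Valuation (PadicAlgCl ℓ) NNReal).valuationSubring.subtype = Literature.NumberTheory.Automorphic.arithFrobPolyOfSatake ι v.residueCard 1 α ∧ P₀.map θ = Pb) → ∃ π : Literature.NumberTheory.Automorphic.CuspidalAutomorphicRepData 2 K hcpt, π.1.IsLAlgebraic ∧ Summit.Langlands.Corresponds RD ι π.1 ρ)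

/-- item stmt-Langlands-2381 · support · rank 9 · open · by planner
sources: arXiv:1412.1533, arXiv:1411.7260, KhareThorne2017
[support] The coincidence itself, as arithmetic provable NOW in the tree's own barrier vocabulary:
for K CM with d complex places and n >= 1, (automorphic) dim T(Z_p) - rank O_K^x - l_0 = n[K:Q] -
Units.rank K - defectGL(r_1, r_2, n) = dn + 1 and (Galois) 1 + d n^2 - [K:Q] n(n-1)/2 = dn + 1
(Greenberg–Wiles Euler characteristic d n^2 for ad rho over a totally complex field; codimension
[K_v:Q_p] n(n-1)/2 of the trianguline variety in the local framed deformation space, BHS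
arXiv:1411.7260 Thm 2.6 / arXiv:2504.18319 §6: dim X_tri = n^2 + [K_v:Q_p] n(n+1)/2). Proof:
IsCMField => nrRealPlaces = 0, finrank = 2 nrComplexPlaces (card_add_two_mul_card_eq_rank),
Units.rank = card InfinitePlace - 1, defectGL_totallyComplex, then ring arithmetic in Z. The
Leopoldt defect delta_K enters both sides identically (closure of units in the weight space;
h^1(G_{K,S}, Q_p) = 1 + d + delta_K in the twist directions) and is therefore omitted. -/
@[route_item "route-Langlands-NewtonPatching"]
def Numerology : Prop :=
  ∀ (K : Type) [Field K] [NumberField K], NumberField.IsCMField K → ∀ n : ℕ, 1 ≤ n → ((n * Module.finrank ℚ K : ℕ) : ℤ) - (NumberField.Units.rank K : ℤ) - (Literature.Barriers.Langlands.defectGL (NumberField.InfinitePlace.nrRealPlaces K) (NumberField.InfinitePlace.nrComplexPlaces K) n : ℤ) = (NumberField.InfinitePlace.nrComplexPlaces K : ℤ) * n + 1 ∧ (1 : ℤ) + (NumberField.InfinitePlace.nrComplexPlaces K : ℤ) * n ^ 2 - (Module.finrank ℚ K : ℤ) * ((n * (n - 1) / 2 : ℕ) : ℤ) = (NumberField.InfinitePlace.nrComplexPlaces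 K : ℤ) * n + 1

/-- item stmt-Langlands-2382 · support · rank 9 · open · by planner
sources: Mathlib.Topology.KrullDimension, arXiv:1411.7260
[support] The commutative-algebra step replacing patching, Mathlib-sized: an irreducible closed
subset C contained in an irreducible component C' of finite topological Krull dimension with dim C'
<= dim C equals C' (chains of irreducible closed subsets of C extend by C'). Applied with C a
component of the eigenvariety (dim >= N by Newton) inside X^glob_tri (components of dim N by crux
DualTriangulineSelmerVanishing) it gives 'X is a union of irreducible components of X^glob_tri'.
Mathlib: irreducibleComponents, topologicalKrullDim (Topology/KrullDimension),
IsClosedEmbedding.topologicalKrullDim_le. -/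
@[route_item "route-Langlands-NewtonPatching"]
def UnionOfComponents : Prop :=
  ∀ (X : Type) [TopologicalSpace X] (C C' : Set X), IsIrreducible C → IsClosed C → C' ∈ irreducibleComponents X → C ⊆ C' → topologicalKrullDim ↥C' ≠ ⊤ → topologicalKrullDim ↥C' ≤ topologicalKrullDim ↥C → C = C'

/-- item stmt-Langlands-2383 · support · rank 9 · closed · proved by Summit.Langlands.Langlands.Theorems.WeakToStrong.weakToStrong_proof @ 99c3d239a805 (prover) · by planner
sources: BuzzardGeeLMS2014, SerreAbelianLadic1968
[support] Upgrade used by every (B)-engine: if (A) holds for (n, K, RD) and an irreducible rho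
matches an L-algebraic cuspidal pi at all but finitely many places (SatakeFrobCompatibleAt), then
Corresponds RD iota pi rho at every finite place. Proof sketch: (A) gives rho' irreducible with
Corresponds; Satake parameters are unique, so rho and rho' have equal Frobenius charpolys at
cofinitely many v; Chebotarev (tree: absoluteGaloisGroup.frobenius_dense, chebotarev_artinRep_holds)
+ continuity give equal characteristic polynomials on Gamma_K; Brauer–Nesbitt in characteristic 0
(tree: Literature.RepresentationTheory.Semisimple.EquivOfCharacter) gives rho ≅ rho';
LocalGlobalCompatibleAt is invariant under FramedRep.conj (PstWeilDeligneData.conj axiom;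
IsWeilDeligneOfLadic up to isomorphism). If some accepted predicate turns out not conj-invariant,
report it — that is a finding about the summit rendering. -/
@[route_item "route-Langlands-NewtonPatching"]
def WeakToStrong : Prop :=
  ∀ (K : Type) [Field K] [NumberField K] (n : ℕ) (hcpt : Literature.NumberTheory.Automorphic.isCompact_glFiniteIntegralLevel n K) (RD : Summit.Langlands.ReciprocityData K) (ℓ : ℕ) [Fact ℓ.Prime] (ι : PadicAlgCl ℓ ≃+* ℂ) (π : Literature.NumberTheory.Automorphic.CuspidalAutomorphicRepData n K hcpt) (ρ : Literature.NumberTheory.GaloisRepresentations.FramedGaloisRep K (PadicAlgCl ℓ) n), Summit.Langlands.AutomorphicToGalois n RD hcpt → π.1.IsLAlgebraic → ρ.toGaloisRep.IsIrreducible → (∀ᶠ v : IsDedekindDomain.HeightOneSpectrum (NumberField.RingOfIntegers K) in cofinite, Summit.Langlands.SatakeFrobCompatibleAt ι π.1 ρ v) → Summit.Langlands.Corresponds RD ι π.1 ρ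

/-- item stmt-Langlands-2384 · support · rank 9 · open · by planner
sources: ACCGHLNSTT2023, arXiv:2301.10509, arXiv:1910.12986
[support] Weight-0 elliptic face of the Target, junk-free (no RD): K CM, E/K an integral Weierstrass
model with Δ ≠ 0 and no geometric CM, p >= 5 totally split in K and good for E, rhobar_{E,p}
surjective, residually modular through a weight-zero cuspidal pi_0 of GL_2(A_K) (a.e. ‖ι⁻¹(√q_w(α+β)
− a_w(E))‖ < 1) => E modular (weight-zero cuspidal pi with √q_w(α+β) = a_w(E) a.e.; normalisation of
the accepted Literature.NumberTheory.Automorphic.potentiallyModular_ellipticCurve_CM). CALIBRATION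
ITEM: at a totally split p >= 5 the local representation is Fontaine–Laffaille regardless of slope,
so this is essentially ACCGHLNSTT2023 Thm 6.1.1 (FL case; check decomposed-generic and the image
hypotheses from surjectivity) or Caraiani–Newton arXiv:2301.10509 §5 (Barsotti–Tate). Demoted from
crux for that reason; closing it formally exercises the vocabulary the Target uses. -/
@[route_item "route-Langlands-NewtonPatching"]
def EllipticAnySlopeCM : Prop :=
  ∀ (K : Type) [Field K] [NumberField K], NumberField.IsCMField K → ∀ (hcpt : Literature.NumberTheory.Automorphic.isCompact_glFiniteIntegralLevel 2 K) (E : WeierstrassCurve (NumberField.RingOfIntegers K)), E.Δ ≠ 0 → ¬ (E.baseChange K).HasCM → (∃ (p : ℕ) (_ : Fact p.Prime) (ι : PadicAlgCl p ≃+* ℂ) (π₀ : Literature.NumberTheory.Automorphic.CuspidalAutomorphicRepData 2 K hcpt), 5 ≤ p ∧ (∀ v : IsDedekindDomain.HeightOneSpectrum (NumberField.RingOfIntegers K), ((p : ℕ) : NumberField.RingOfIntegers K) ∈ v.asIdeal → v.residueCard = p ∧ ¬ v.asIdeal ^ 2 ∣ Ideal.span {((p : ℕ) : NumberField.RingOfIntegers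 K)} ∧ E.Δ ∉ v.asIdeal) ∧ (E.baseChange K).HasSurjectiveModNGaloisRep (p : ℤ) ∧ π₀.1.HasWeightZero ∧ ∀ᶠ w : IsDedekindDomain.HeightOneSpectrum (NumberField.RingOfIntegers K) in cofinite, ∃ α : Multiset ℂ, π₀.1.HasSatakeParamAt w α ∧ ‖ι.symm (((Real.sqrt w.residueCard : ℝ) : ℂ) * α.sum - (Literature.NumberTheory.Automorphic.frobTraceAt E w : ℂ))‖ < 1) → ∃ π : Literature.NumberTheory.Automorphic.CuspidalAutomorphicRepData 2 K hcpt, π.1.HasWeightZero ∧ ∀ᶠ w : IsDedekindDomain.HeightOneSpectrum (NumberField.RingOfIntegers K) in cofinite, ∃ α : Multiset ℂ, π.1.HasSatakeParamAt w α ∧ ((Real.sqrt w.residueCard : ℝ) : ℂ) * α.sum = (Literature.NumberTheory.Automorphic.frobTraceAt E w : ℂ)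

/-- item stmt-Langlands-2385 · support · rank 9 · open · by planner
sources: BuzzardGeeLMS2014
[support] Honest complement over CM fields: Target -> (Langlands for all CM K). Everything this
route does NOT address over CM fields lives here: direction (A) for irregular L-algebraic pi
(NonRegularWeightBarrier), (B) for irregular / non-crystalline-at-ell / ell not totally split /
residually reducible, inadequate or non-automorphic rho (Serre-type conjectures over CM fields),
uniqueness clause of (A). True iff Langlands holds over CM fields; unprovable in isolation;
bookkeeping for the Assembly. -/
@[route_item "route-Langlands-NewtonPatching"]
def RestCM : Prop :=
  (∀ (K : Type) [Field K] [NumberField K], NumberField.IsCMField K → ∃ RD : Summit.Langlands.ReciprocityData K, (∀ (n : ℕ), 0 < n → ∀ (hcpt : Literature.NumberTheory.Automorphic.isCompact_glFiniteIntegralLevel n K) (π : Literature.NumberTheory.Automorphic.CuspidalAutomorphicRepData n K hcpt), π.1.IsLAlgebraic → (∃ T : Literature.NumberTheory.Automorphic.InfinityType K n, π.1.HasInfinityType T ∧ T.IsRegular) → ∀ (ℓ : ℕ) [Fact ℓ.Prime] (ι : PadicAlgCl ℓ ≃+* ℂ), ∃ ρ : Literature.NumberTheory.GaloisRepresentations.FramedGaloisRep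 K (PadicAlgCl ℓ) n, ρ.toGaloisRep.IsIrreducible ∧ Summit.Langlands.IsGeometricFramed RD ρ ∧ Summit.Langlands.Corresponds RD ι π.1 ρ) ∧ (∀ (n : ℕ), 0 < n → ∀ (hcpt : Literature.NumberTheory.Automorphic.isCompact_glFiniteIntegralLevel n K) (ℓ : ℕ) [Fact ℓ.Prime] (ι : PadicAlgCl ℓ ≃+* ℂ) (ρ : Literature.NumberTheory.GaloisRepresentations.FramedGaloisRep K (PadicAlgCl ℓ) n), (∀ v : IsDedekindDomain.HeightOneSpectrum (NumberField.RingOfIntegers K), ((ℓ : ℕ) : NumberField.RingOfIntegers K) ∈ v.asIdeal → v.residueCard = ℓ ∧ ¬ v.asIdeal ^ 2 ∣ Ideal.span {((ℓ : ℕ) : NumberField.RingOfIntegers K)}) → ρ.toGaloisRep.IsIrreducible → Summit.Langlands.IsGeometricFramed RD ρ → (∀ (v : IsDedekindDomain.HeightOneSpectrum (NumberField.RingOfIntegers K)) (hv : ((ℓ : ℕ) : NumberField.RingOfIntegers K) ∈ v.asIdeal), (∀ r, (RD.pst ℓ v hv).IsWeilDeligneOf (ρ.toLocal v) r → r.N =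 0 ∧ Literature.NumberTheory.GaloisRepresentations.WeilGroup.IsUnramifiedRep r.ρ) ∧ ∃ (E : IntermediateField ℚ_[ℓ] (PadicAlgCl ℓ)) (_ : FiniteDimensional ℚ_[ℓ] E) (rE : Literature.NumberTheory.GaloisRepresentations.FramedGaloisRep (v.adicCompletion K) E n), Literature.NumberTheory.Automorphic.HasQlModel (ρ.toLocal v) E rE ∧ (letI := (RD.pst ℓ v hv).algebra; ((RD.pst ℓ v hv).𝔅.hodgeTateWeights (Literature.NumberTheory.Automorphic.restrictScalarsQl E rE)).toFinset.card = n)) → (∃ (k : Type) (_ : Field k) (_ : CharP k ℓ) (_ : TopologicalSpace k) (_ : DiscreteTopology k) (θ : ↥(Valued.v : Valuation (PadicAlgCl ℓ) NNReal).valuationSubring →+* k) (ρb : Literature.NumberTheory.GaloisRepresentations.ModPGaloisRep K k n) (π₀ : Literature.NumberTheory.Automorphic.CuspidalAutomorphicRepData n K hcpt), Literature.NumberTheory.GaloisRepresentations.FramedRep.IsAbsolutelyIrreducible ρb ∧ π₀.1.IsLAlgebraic ∧ (∃ T : Literature.NumberTheory.Automorphic.InfinityType K n, π₀.1.HasInfinityType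 T ∧ T.IsRegular) ∧ ∀ᶠ v : IsDedekindDomain.HeightOneSpectrum (NumberField.RingOfIntegers K) in cofinite, ∃ (P P₀ : Polynomial ↥(Valued.v : Valuation (PadicAlgCl ℓ) NNReal).valuationSubring) (Pb : Polynomial k) (α : Multiset ℂ), ρ.HasFrobCharpolyAt v (P.map (Valued.v : Valuation (PadicAlgCl ℓ) NNReal).valuationSubring.subtype) ∧ ρb.HasFrobCharpolyAt v Pb ∧ P.map θ = Pb ∧ π₀.1.HasSatakeParamAt v α ∧ P₀.map (Valued.v : Valuation (PadicAlgCl ℓ) NNReal).valuationSubring.subtype = Literature.NumberTheory.Automorphic.arithFrobPolyOfSatake ι v.residueCard 1 α ∧ P₀.map θ = Pb) → ∃ π : Literature.NumberTheory.Automorphic.CuspidalAutomorphicRepData n K hcpt, π.1.IsLAlgebraic ∧ Summit.Langlands.Corresponds RD ι π.1 ρ)) → (∀ (K : Type) [Field K] [NumberField K], NumberField.IsCMField K → ∃ RD : Summit.Langlands.ReciprocityData K, ∀ n : ℕ, 0 < n → ∀ hcpt : Literature.NumberTheory.Automorphic.isCompact_glFiniteIntegralLevel n K, Summit.Langlands.GlobalLanglandsCorrespondenceGLn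 n K RD hcpt)

/-- item stmt-Langlands-2386 · support · rank 9 · open · by planner
sources: BuzzardGeeLMS2014
[support] Honest complement by base field: the summit statement for number fields that are not CM
(totally real fields: other routes; mixed signature: ShimuraVarietyRealizationBarrier). Bookkeeping
for the Assembly. -/
@[route_item "route-Langlands-NewtonPatching"]
def NonCM : Prop :=
  ∀ (K : Type) [Field K] [NumberField K], ¬ NumberField.IsCMField K → ∃ RD : Summit.Langlands.ReciprocityData K, ∀ n : ℕ, 0 < n → ∀ hcpt : Literature.NumberTheory.Automorphic.isCompact_glFiniteIntegralLevel n K, Summit.Langlands.GlobalLanglandsCorrespondenceGLn n K RD hcpt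

/-- item stmt-Langlands-2387 · assembly · rank 1 · open · by planner
[assembly] (Langlands over CM fields) -> (Langlands over non-CM fields) -> Langlands; with support
RestCM : Target -> (Langlands over CM fields) this is the chain Target => summit. Pure logic
(by_cases NumberField.IsCMField F). The mathematical glue 'cruxes 2-6 => Target' is deliberately NOT
an item yet (two-layer rule): it needs the requested definitions (TriangulineAt,
GlobalTriangulineSpace, DualTriangulineSelmer, Eigenvariety) and will be installed by a split of
Target once a crux closes. -/
@[route_item "route-Langlands-NewtonPatching"]
def Assembly : Prop :=
  (∀ (K : Type) [Field K] [NumberField K], NumberField.IsCMField K → ∃ RD : Summit.Langlands.ReciprocityData K, ∀ n : ℕ, 0 < n → ∀ hcpt : Literature.NumberTheory.Automorphic.isCompact_glFiniteIntegralLevel n K, Summit.Langlands.GlobalLanglandsCorrespondenceGLn n K RD hcpt) → (∀ (K : Type) [Field K] [NumberField K], ¬ NumberField.IsCMField K → ∃ RD : Summit.Langlands.ReciprocityData K, ∀ n : ℕ, 0 < n → ∀ hcpt : Literature.NumberTheory.Automorphic.isCompact_glFiniteIntegralLevel n K, Summit.Langlands.GlobalLanglandsCorrespondenceGLn n K RD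 hcpt) → Langlands

end Summit.Langlands.Langlands.Theses.NewtonPatching
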